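import Summits.BirchSwinnertonDyer.BirchSwinnertonDyer.Theses.SmallImageMuTransfer
import Summits.BirchSwinnertonDyer.BirchSwinnertonDyer.Theorems.SmallImageMuTransferMuTransferX9NormCompatibleIntegral
import Literature.NumberTheory.EllipticCurves.Kato2004.IwasawaH1ReductionRoots
import HarnessLib

/-!
# Item `KatoReductionModPKernel` of route `SmallImageMuTransfer` (stmt-BirchSwinnertonDyer-19844) — CLOSED:
# F2 = Kato 2004 §13.8 "`𝐇¹(T)/p𝐇¹(T) ⊂ 𝐇¹(T/p)`" on the pin `Kato2004.IwasawaH1Data` is a tree theorem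

Cell `bsd-smallim`, seat `bsd-smallim-k6-lur-a` (gen 2).  The aside 19844 is the by-name alias of the named
Literature fact `Kato2004.mem_pSmul_of_red_eq_zero` (hypothesis F2 of `MuTransferX9Core`).  It is proved by
k6-g4's reduction `Kato2004.mem_pSmul_of_red_eq_zero_of_integral_of_smul_mem` (levelwise kernel + norm-compatible
`p`-th roots, `Kato2004/IwasawaH1ReductionKernel`, `…Roots`) applied to this seat's weak Lemma 8.5 (2) on the pin
`UniversalNorms.mem_integralH1_of_layerCores_eq_of_smul_mem` (`…X9NormCompatibleIntegral`, with k6-g3's and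
k6-g4's tools).  HONEST FRAMING: closes an ASIDE of rung K6's route; BSD is not proved by this; the deciding
crux `MuTransferX9` (19276) remains open modulo F1 = `Kato2004.exists_divisibilityInputs_fineQuotient_zeta`.

References: K. Kato, Astérisque 295 (2004), §13.8 (pp. 228–229), Lemma 8.5 (2) (p. 184) [Kato2004Asterisque].
-/

noncomputable section

set_option linter.dupNamespace false

namespace Summit.BirchSwinnertonDyer.BirchSwinnertonDyer.Theorems

/-- **Item 19844 `KatoReductionModPKernel` PROVED**: Kato's §13.8 kernel statement on the pin (F2) holds, by
`Kato2004.mem_pSmul_of_red_eq_zero_of_integral_of_smul_mem` and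
`UniversalNorms.mem_integralH1_of_layerCores_eq_of_smul_mem`.
[cite: Kato2004Asterisque, §13.8 (pp. 228–229) with Lemma 8.5 (2) (p. 184)] -/
theorem smallImageMuTransfer_KatoReductionModPKernel_proof :
    Summit.BirchSwinnertonDyer.BirchSwinnertonDyer.Theses.SmallImageMuTransfer.KatoReductionModPKernel := by
  unfold Summit.BirchSwinnertonDyer.BirchSwinnertonDyer.Theses.SmallImageMuTransfer.KatoReductionModPKernel
  exact Literature.NumberTheory.EllipticCurves.Kato2004.mem_pSmul_of_red_eq_zero_of_integral_of_smul_mem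
    Summit.BirchSwinnertonDyer.BirchSwinnertonDyer.Rank1Residual.UniversalNorms.mem_integralH1_of_layerCores_eq_of_smul_mem

end Summit.BirchSwinnertonDyer.BirchSwinnertonDyer.Theorems

end
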